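import Literature.Analysis.FluidPDE.ElgindiMomentCalculus
import Literature.Analysis.FluidPDE.ElgindiTrigCoefficients
import HarnessLib

/-!
# Words `D_θ^iD_z^j` of a test function: global regularity and support
([Elgindi2021] §6.3 / [ElgindiGhoulMasmoudi2021] §3.1, the functions `D_θ^{k−j}D_y^jf`)

Topic `Literature/Analysis/FluidPDE`. Proof file (everything proved, no definitions, no named
facts) on the proof path of the named fact
`Literature.Analysis.FluidPDE.Elgindi.ElgindiGhoulMasmoudi2021_stabilityCore`
(`ElgindiStabilityDecomposition.lean`). In the `𝓗ᵏ` coercivity inductions of T. M. Elgindi,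
Ann. of Math. 194 (2021) = arXiv:1904.04795, §6.3 and of Elgindi–Ghoul–Masmoudi, arXiv:1910.14071,
§3.1, the coercivity of the local part is applied to the words `u = D_θ^iD_z^jf` of the test function
`f`; this needs `u` to be again a test function (smooth, compactly supported inside the open strip).
This file: `D_θg ∈ Cⁿ(ℝ²)` for `g ∈ Cⁿ⁺¹(ℝ²)` (no support condition), hence
`D_θ^iD_z^jf ∈ Cⁿ` for `f ∈ C^{n+i+j}`, with compact support inside that of `f`; and the smoothness
of the iterated angular derivatives `D_θ^lG` of a function smooth on the open quarter.
-/

noncomputable section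

open MeasureTheory Set Function Real Filter
open _root_.Topology

namespace Literature.Analysis.FluidPDE

namespace Elgindi

/-! ### Global regularity of `∂_θ g`, `D_θ g` -/

/-- `∂_θ g ∈ Cⁿ(ℝ²)` for `g ∈ Cⁿ⁺¹(ℝ²)`. [folklore] -/
theorem contDiff_dθ_of_contDiff {g : ℝ → ℝ → ℝ} {n : ℕ} (hg : ContDiff ℝ (n + 1) (uncurry g)) :
    ContDiff ℝ n (uncurry (dθ g)) := by
  have h : ContDiff ℝ n fun p : ℝ × ℝ => fderiv ℝ (uncurry g) p (0, 1) :=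
    (hg.fderiv_right le_rfl).clm_apply contDiff_const
  have e : uncurry (dθ g) = fun p : ℝ × ℝ => fderiv ℝ (uncurry g) p (0, 1) :=
    funext fun p => dθ_eq_fderiv ((hg.differentiable (by simp)) p)
  rw [e]
  exact h

/-- `D_θ g ∈ Cⁿ(ℝ²)` for `g ∈ Cⁿ⁺¹(ℝ²)` (no support condition). [folklore] -/
theorem contDiff_Dθ_of_contDiff {g : ℝ → ℝ → ℝ} {n : ℕ} (hg : ContDiff ℝ (n + 1) (uncurry g)) :
    ContDiff ℝ n (uncurry (Dθ g)) := by
  have hs : ContDiff ℝ n fun p : ℝ × ℝ => Real.sin (2 * p.2) := by fun_prop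
  have h := hs.mul (contDiff_dθ_of_contDiff hg)
  have e : uncurry (Dθ g) = fun p : ℝ × ℝ => Real.sin (2 * p.2) * uncurry (dθ g) p := by
    funext p
    simp only [Function.uncurry, Dθ_eq_mul_dθ]
  rw [e]
  exact h

/-- Iterates: `D_θ^i g ∈ Cⁿ` for `g ∈ C^{n+i}`. [folklore] -/
theorem contDiff_iterate_Dθ_of_contDiff {g : ℝ → ℝ → ℝ} {i n : ℕ} (hg : ContDiff ℝ (n + i) (uncurry g)) :
    ContDiff ℝ n (uncurry (Dθ^[i] g)) := by
  induction i generalizing g with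
  | zero => simpa using hg
  | succ i ih =>
    rw [Function.iterate_succ_apply]
    refine ih (g := Dθ g) (contDiff_Dθ_of_contDiff ?_)
    have e : ((n + (i + 1) : ℕ) : WithTop ℕ∞) = (n + i : ℕ) + 1 := by push_cast; ring
    rw [← e]; exact hg

/-- **Words of a smooth function are smooth**: `D_θ^iD_z^jf ∈ Cⁿ` for `f ∈ C^{n+i+j}`. [folklore] -/
theorem contDiff_iterate_Dθ_Dz_of_contDiff {f : ℝ → ℝ → ℝ} {i j n : ℕ} (hf : ContDiff ℝ (n + i + j) (uncurry f)) :
    ContDiff ℝ n (uncurry (Dθ^[i] (Dz^[j] f))) :=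
  contDiff_iterate_Dθ_of_contDiff (contDiff_iterate_Dz_of_contDiff hf)

/-- Words of a smooth function are smooth, `∀ n` form. [folklore] -/
theorem contDiff_iterate_Dθ_Dz_of_forall {f : ℝ → ℝ → ℝ} (hf : ∀ n : ℕ, ContDiff ℝ n (uncurry f)) (i j n : ℕ) :
    ContDiff ℝ n (uncurry (Dθ^[i] (Dz^[j] f))) :=
  contDiff_iterate_Dθ_Dz_of_contDiff (hf (n + i + j))

/-! ### Support of the words -/

/-- Iterates of `D_θ` keep compact support. [folklore] -/
theorem hasCompactSupport_iterate_Dθ {g : ℝ → ℝ → ℝ} (hs : HasCompactSupport (uncurry g)) (i : ℕ) :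
    HasCompactSupport (uncurry (Dθ^[i] g)) := by
  induction i generalizing g with
  | zero => simpa using hs
  | succ i ih => rw [Function.iterate_succ_apply]; exact ih (hasCompactSupport_Dθ hs)

/-- Iterates of `D_θ` do not enlarge the support. [folklore] -/
theorem tsupport_iterate_Dθ_subset {g : ℝ → ℝ → ℝ} (i : ℕ) :
    tsupport (uncurry (Dθ^[i] g)) ⊆ tsupport (uncurry g) := by
  induction i generalizing g with
  | zero => simp
  | succ i ih => rw [Function.iterate_succ_apply]; exact (ih (g := Dθ g)).trans tsupport_Dθ_subset

/-- **Words keep compact support.** [folklore] -/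
theorem hasCompactSupport_iterate_Dθ_Dz {f : ℝ → ℝ → ℝ} (hs : HasCompactSupport (uncurry f)) (i j : ℕ) :
    HasCompactSupport (uncurry (Dθ^[i] (Dz^[j] f))) :=
  hasCompactSupport_iterate_Dθ (hasCompactSupport_iterate_Dz hs j) i

/-- **Words do not enlarge the support** (so stay supported inside the open strip). [folklore] -/
theorem tsupport_iterate_Dθ_Dz_subset {f : ℝ → ℝ → ℝ} (i j : ℕ) :
    tsupport (uncurry (Dθ^[i] (Dz^[j] f))) ⊆ tsupport (uncurry f) :=
  (tsupport_iterate_Dθ_subset i).trans (tsupport_iterate_Dz_subset j)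

/-! ### Iterated angular derivatives of a function smooth on the open quarter -/

/-- `Dθ₁` maps `C^{n+1}(0, π/2)` to `C^n(0, π/2)`. [folklore] -/
theorem contDiffOn_Dθ₁_Ioo {G : ℝ → ℝ} {n : WithTop ℕ∞} (hG : ContDiffOn ℝ (n + 1) G (Ioo 0 (π / 2))) :
    ContDiffOn ℝ n (Dθ₁ G) (Ioo 0 (π / 2)) := by
  have hs : ContDiffOn ℝ n (fun θ : ℝ => Real.sin (2 * θ)) (Ioo 0 (π / 2)) := by fun_prop
  have h := hs.mul (hG.deriv_of_isOpen isOpen_Ioo le_rfl)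
  exact h.congr fun θ _ => rfl

/-- Iterates: `G ∈ C^N(0,π/2)` has `Dθ₁^l G ∈ C^m(0,π/2)` for `l + m ≤ N`. [folklore] -/
theorem contDiffOn_iterate_Dθ₁_Ioo {G : ℝ → ℝ} {N : ℕ} (hG : ContDiffOn ℝ N G (Ioo 0 (π / 2))) {l m : ℕ}
    (h : l + m ≤ N) : ContDiffOn ℝ m (Dθ₁^[l] G) (Ioo 0 (π / 2)) := by
  induction l generalizing m with
  | zero => exact hG.of_le (by exact_mod_cast (by omega : m ≤ N))
  | succ l ih =>
    rw [Function.iterate_succ_apply']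
    have h1 : ContDiffOn ℝ ((m + 1 : ℕ) : WithTop ℕ∞) (Dθ₁^[l] G) (Ioo 0 (π / 2)) := ih (by omega)
    exact contDiffOn_Dθ₁_Ioo (by exact_mod_cast h1)

end Elgindi

end Literature.Analysis.FluidPDE
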